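import Summits.QuantumFields.GaugeBoot.HaarShiftPlaquetteAverage
import Summits.QuantumFields.GaugeBoot.CutLoopCharacterPositivity
import Summits.QuantumFields.GaugeBoot.ClassBLimitPoints
import Literature.MathematicalPhysics.QuantumLattice.LatticeGaugeDLRLimitPointsProofs
import HarnessLib

/-!
# The DLR plaquette sign rule: in every one-link Haar-shift state the mean plaquette around a link
has the sign of `β` — infinite volume, no partition function (gauge-boot, Class B; 2/2)

HONEST FRAMING (cell `pub-gaugeboot`, page 1 of every file): the venture produces certified bounds
on lattice expectations at stated coupling, gauge group, dimension and torus size; NOT a mass gap,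
NOT a continuum limit, NOT a string tension; NOT Yang–Mills-summit-bearing (barriers
`FixedCouplingUltralocality`, `PerturbativeInvisibility`). Structural statement for the Class-B
column (SCOPING A18); certifies no number.

## Content

`G` compact metrisable, `ρ : G → M_N(ℂ)` continuous (`N ≥ 1`) WITHOUT INVARIANT VECTORS in the form
`hρ0 : ∀ m, ∫ Re tr ρ(g m) dg = 0` (every non-trivial irreducible `ρ`; every `ρ` with a central
scalar `ω ≠ 1`, `integral_re_trace_mul_eq_zero_of_smul_one`), `μ` a probability measure on
`LGConfig d G` with the one-link Haar-shift (DLR) identity `IsHaarShiftState ρ β μ` — no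
translation invariance, no extremality, no reflection positivity assumed.

* (part 1, `HaarShiftPlaquetteAverage.lean`) the Haar average over `g` of
  `Δ_g(U) = S_e(U[e ↦ g⁻¹U_e]) - S_e(U)` is `A_e(U) = Σ_{p ∋ e} Re tr ρ(U_p)`, pointwise in `U`;
  and `∫ (∫ Δ_g dμ) dg = Σ_{p ∋ e} ∫ Re tr ρ(U_p) dμ` (Fubini); here:
  `IsHaarShiftState.mul_integral_shiftAction_nonneg` (`β ∫ Δ_g dμ ≥ 0`, Jensen on the trivial
  observable), `IsHaarShiftState.shiftAction_eq_zero_of_integral_eq_zero` (`HaarShiftSupport`),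
  `shiftAction_one` (`Δ_g(1) = #{p ∋ e}(N - Re tr ρ(g))`).
* ★★★ **`IsHaarShiftState.sum_integral_plaquetteObs_neg_of_neg`** /
  **`…_pos_of_pos`** — THE DLR SIGN RULE: for `β < 0` (resp. `β > 0`) and every link `e`,
  `Σ_{p ∋ e} ∫ Re tr ρ(U_p) dμ < 0` (resp. `> 0`). (Jensen on the Haar-shift identity with the
  trivial observable gives `sign(β) ∫ Δ_g dμ ≥ 0` for every `g`; average over `g`; strictness from
  `HaarShiftSupport`: `∫ Δ_g = 0` for all `g` would force `Re tr ρ ≡ N`.) The infinite-volume,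
  partition-function-free analogue of the torus theorem `wilsonExpectation_re_trace_plaquette_pos/neg`.
* ★★★ **`ClassBState.false_of_neg'`** / **`isEmpty_classBState_of_neg'`** /
  **`not_thermodynamicLimitIsClassB_of_neg'`** — Class B is empty at `β < 0` for EVERY such `ρ`
  (generalising `ClassBNegativeCouplingEmpty.lean` from central scalars to representations without
  invariant vectors): diagonal RP gives `u_p ≥ 0` for every plaquette, the sign rule gives
  `Σ_{p ∋ e} u_p < 0`; `integral_re_trace_mul_eq_zero_of_smul_one` — a central scalar `ω ≠ 1`
  implies `hρ0`.
* ★★ **`sum_integral_plaquetteObs_pos_of_mem_infiniteVolumeLimitPoints`** — at `β > 0` every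
  infinite-volume limit point of the torus Wilson states has `Σ_{p ∋ e} ∫ Re tr ρ(U_p) dμ > 0`
  (strictly), and `< 0` at `β < 0`.

Elementary; not in print in this form as far as the cell's searches go (DLR states: Georgii 2011
§2; the finite-volume sign of the plaquette: Montvay–Münster 1994 §3.2).
-/

open MeasureTheory Complex Finset Function
open scoped ComplexOrder

namespace Summit.QuantumFields.GaugeBoot

open Literature.MathematicalPhysics.QuantumFieldTheory (haarProbability integrable_haar_of_continuous)
open Literature.MathematicalPhysics.QuantumLattice
open Literature.RepresentationTheory.CompactGroups

noncomputable section

variable {d N : ℕ} {G : Type*} [Group G] [TopologicalSpace G] [IsTopologicalGroup G]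
  [CompactSpace G] [MeasurableSpace G] [BorelSpace G] (ρ : G →* Matrix (Fin N) (Fin N) ℂ)

/-! ## The sign rule -/

section SignRule

variable [NeZero N] [SecondCountableTopology G]

omit [NeZero N] in
/-- `β ∫ Δ_g dμ ≥ 0` for every `g` (Jensen: `e^{-βΔ} ≥ 1 - βΔ` and `∫ e^{-βΔ_g} dμ = 1`). -/
theorem IsHaarShiftState.mul_integral_shiftAction_nonneg (hρ : Continuous ρ) {β : ℝ}
    {μ : Measure (LGConfig d G)} [IsProbabilityMeasure μ] (hμ : IsHaarShiftState ρ β μ)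
    (e : ZdEdge d) (g : G) :
    0 ≤ β * ∫ U, (wilsonBoundaryAction ρ {e} (Function.update U e (g⁻¹ * U e)) -
      wilsonBoundaryAction ρ {e} U) ∂μ := by
  set Δ : LGConfig d G → ℝ := fun U =>
    wilsonBoundaryAction ρ {e} (Function.update U e (g⁻¹ * U e)) - wilsonBoundaryAction ρ {e} U
    with hΔ
  have hΔc : Continuous Δ := continuous_shiftAction ρ hρ e g
  have hΔi : Integrable Δ μ := integrable_of_continuous_real hΔc μ
  have hexp : ∫ U, Real.exp (-(β * Δ U)) ∂μ = 1 := hμ.integral_exp_shiftAction ρ e g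
  have hle : ∫ U, (1 - β * Δ U) ∂μ ≤ ∫ U, Real.exp (-(β * Δ U)) ∂μ := by
    refine integral_mono ((integrable_const _).sub (hΔi.const_mul _))
      (integrable_of_continuous_real (Real.continuous_exp.comp ((hΔc.const_mul β).neg)) μ)
      fun U => ?_
    have h := Real.add_one_le_exp (-(β * Δ U))
    simp only
    linarith
  rw [integral_sub (integrable_const _) (hΔi.const_mul _), integral_const, probReal_univ,
    integral_const_mul, hexp] at hle
  simp only [smul_eq_mul, mul_one] at hle
  change 0 ≤ β * ∫ U, Δ U ∂μ
  linarith

omit [NeZero N] in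
/-- If `∫ Δ_g dμ = 0` (`β ≠ 0`) then `Δ_g ≡ 0`: the convexity defect `e^{-βΔ} - 1 + βΔ ≥ 0` has
zero mean and Haar-shift states charge every cylinder (`HaarShiftSupport`). -/
theorem IsHaarShiftState.shiftAction_eq_zero_of_integral_eq_zero (hρ : Continuous ρ) {β : ℝ}
    (hβ : β ≠ 0) {μ : Measure (LGConfig d G)} [IsProbabilityMeasure μ] (hμ : IsHaarShiftState ρ β μ)
    (e : ZdEdge d) (g : G)
    (h0 : ∫ U, (wilsonBoundaryAction ρ {e} (Function.update U e (g⁻¹ * U e)) -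
      wilsonBoundaryAction ρ {e} U) ∂μ = 0) (U : LGConfig d G) :
    wilsonBoundaryAction ρ {e} (Function.update U e (g⁻¹ * U e)) - wilsonBoundaryAction ρ {e} U
      = 0 := by
  set Δ : LGConfig d G → ℝ := fun U =>
    wilsonBoundaryAction ρ {e} (Function.update U e (g⁻¹ * U e)) - wilsonBoundaryAction ρ {e} U
    with hΔ
  have hΔc : Continuous Δ := continuous_shiftAction ρ hρ e g
  have hΔi : Integrable Δ μ := integrable_of_continuous_real hΔc μ
  set h : LGConfig d G → ℝ := fun U => Real.exp (-(β * Δ U)) - 1 - (-β) * Δ U with hh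
  have hhc : Continuous h :=
    ((Real.continuous_exp.comp ((hΔc.const_mul β).neg)).sub continuous_const).sub (hΔc.const_mul _)
  have hh0 : ∀ U, 0 ≤ h U := fun U => by
    have := Real.add_one_le_exp (-(β * Δ U))
    simp only [hh]; linarith
  have hhS := isCylinder_shiftAction ρ e g
  have hhcyl : IsCylinder h
      (insert e ((plaquettesTouching ({e} : Finset (ZdEdge d))).biUnion plaquetteEdges)) :=
    fun U V hUV => by
      have h1 : Δ U = Δ V := hhS hUV
      simp only [hh, h1]
  have hi1 : Integrable (fun U => Real.exp (-(β * Δ U))) μ :=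
    integrable_of_continuous_real (Real.continuous_exp.comp ((hΔc.const_mul β).neg)) μ
  have hexp : ∫ U, Real.exp (-(β * Δ U)) ∂μ = 1 := hμ.integral_exp_shiftAction ρ e g
  have hi2 : Integrable (fun U => Real.exp (-(β * Δ U)) - 1) μ := hi1.sub (integrable_const _)
  have hi3 : Integrable (fun U => -β * Δ U) μ := hΔi.const_mul _
  have h0' : ∫ U, Δ U ∂μ = 0 := h0
  have hhint : ∫ U, h U ∂μ = 0 := by
    simp only [hh]
    rw [integral_sub hi2 hi3, integral_sub hi1 (integrable_const _), integral_const_mul, h0',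
      integral_const, probReal_univ, hexp]
    simp
  haveI : NeZero μ := ⟨IsProbabilityMeasure.ne_zero μ⟩
  have hzero := IsHaarShiftState.eq_zero_of_integral_eq_zero hμ hhcyl hhc hh0 hhint
  have hU : h U = 0 := by rw [hzero]; rfl
  by_contra hne
  have hx : -(β * Δ U) ≠ 0 := by
    intro hx0
    have : β * Δ U = 0 := by linarith
    rcases mul_eq_zero.1 this with h' | h'
    · exact hβ h'
    · exact hne h'
  have hlt := Real.add_one_lt_exp hx
  simp only [hh] at hU
  linarith

omit [MeasurableSpace G] [BorelSpace G] [NeZero N] [SecondCountableTopology G] in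
/-- The one-link shift at the trivial configuration: `Δ_g(1) = #{p ∋ e} · (N - Re tr ρ(g))`. -/
theorem shiftAction_one (hρ : Continuous ρ) (e : ZdEdge d) (g : G) :
    wilsonBoundaryAction ρ {e} (Function.update (1 : LGConfig d G) e (g⁻¹ * (1 : LGConfig d G) e)) -
        wilsonBoundaryAction ρ {e} (1 : LGConfig d G) =
      (plaquettesTouching ({e} : Finset (ZdEdge d))).card * ((N : ℝ) - ((ρ g).trace).re) := by
  classical
  simp only [wilsonBoundaryAction]
  have hone : ∀ p : ZdPlaquette d, plaquetteObs ρ p.1 p.2.1.1 p.2.1.2 (1 : LGConfig d G) = N :=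
    fun p => by simp [plaquetteObs, plaquetteHolonomyZd, Matrix.trace_one]
  have hupd : Function.update (1 : LGConfig d G) e (1 : G) = 1 := by simp
  have hhol1 : ∀ p : ZdPlaquette d,
      plaquetteHolonomyZd (1 : LGConfig d G) p.1 p.2.1.1 p.2.1.2 = 1 := fun p => by
    simp [plaquetteHolonomyZd]
  have hshift : ∀ p ∈ plaquettesTouching ({e} : Finset (ZdEdge d)),
      plaquetteObs ρ p.1 p.2.1.1 p.2.1.2 (Function.update (1 : LGConfig d G) e g⁻¹) =
        ((ρ g).trace).re := by
    intro p hp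
    have he : e ∈ plaquetteEdges p := by
      obtain ⟨e', he'⟩ := mem_plaquettesTouching_iff.1 hp
      rw [Finset.mem_inter, Finset.mem_singleton] at he'
      exact he'.2 ▸ he'.1
    obtain ⟨a, b, h | h⟩ := plaquetteHolonomyZd_update_affine p he (1 : LGConfig d G)
    · have hab : a * b = 1 := by
        have h1 := h 1
        rw [mul_one, hupd, hhol1] at h1
        exact h1.symm
      have hb : b = a⁻¹ := eq_inv_of_mul_eq_one_right hab
      simp only [plaquetteObs]
      rw [h, hb, CompactGroup.trace_conj_eq ρ g⁻¹ a, CompactGroup.re_trace_map_inv ρ hρ]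
    · have hab : a * b = 1 := by
        have h1 := h 1
        rw [inv_one, mul_one, hupd, hhol1] at h1
        exact h1.symm
      have hb : b = a⁻¹ := eq_inv_of_mul_eq_one_right hab
      simp only [plaquetteObs]
      rw [h, inv_inv, hb, CompactGroup.trace_conj_eq ρ g a]
  simp only [Pi.one_apply, mul_one, hone]
  rw [Finset.sum_congr rfl fun p hp => by rw [hshift p hp], Finset.sum_const, Finset.sum_const,
    nsmul_eq_mul, nsmul_eq_mul]
  ring

omit [TopologicalSpace G] [IsTopologicalGroup G] [CompactSpace G] [MeasurableSpace G] [BorelSpace G]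
  [NeZero N] [SecondCountableTopology G] in
/-- In `d ≥ 2` every link lies on some plaquette. -/
theorem plaquettesTouching_singleton_nonempty (hd : 2 ≤ d) (e : ZdEdge d) :
    (plaquettesTouching ({e} : Finset (ZdEdge d))).Nonempty := by
  obtain ⟨x, i⟩ := e
  obtain ⟨j, hj⟩ : ∃ j : Fin d, j ≠ i := by
    by_cases hi : (i : ℕ) = 0
    · exact ⟨⟨1, by omega⟩, fun h => by have := congrArg Fin.val h; simp at this; omega⟩
    · exact ⟨⟨0, by omega⟩, fun h => by have := congrArg Fin.val h; simp at this; omega⟩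
  rcases lt_or_gt_of_ne hj with hlt | hlt
  · refine ⟨(x, ⟨(j, i), hlt⟩), mem_plaquettesTouching_iff.2 ⟨(x, i), ?_⟩⟩
    simp [plaquetteEdges]
  · refine ⟨(x, ⟨(i, j), hlt⟩), mem_plaquettesTouching_iff.2 ⟨(x, i), ?_⟩⟩
    simp [plaquetteEdges]

/-- ★★★ **THE DLR SIGN RULE.** `G` compact metrisable; `ρ` continuous, `N ≥ 1`, without invariant
vectors (`∫ Re tr ρ(g m) dg = 0` for all `m`); `d ≥ 2`; `μ` a probability measure on `LGConfig d G`
with the one-link Haar-shift (DLR) identity at coupling `β ≠ 0`. Then for every link `e`: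
`0 < β · Σ_{p ∋ e} ∫ Re tr ρ(U_p) dμ` — the mean plaquette around any link has the strict sign of `β`.
No translation invariance, extremality or reflection positivity is assumed. -/
theorem IsHaarShiftState.mul_sum_integral_plaquetteObs_pos (hρ : Continuous ρ)
    (hρ0 : ∀ m : G, ∫ g, ((ρ (g * m)).trace).re ∂(haarProbability G) = 0) (hd : 2 ≤ d) {β : ℝ}
    (hβ : β ≠ 0) {μ : Measure (LGConfig d G)} [IsProbabilityMeasure μ] (hμ : IsHaarShiftState ρ β μ)
    (e : ZdEdge d) :
    0 < β * ∑ p ∈ plaquettesTouching ({e} : Finset (ZdEdge d)),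
      ∫ U, plaquetteObs ρ p.1 p.2.1.1 p.2.1.2 U ∂μ := by
  haveI : (haarProbability G).IsOpenPosMeasure := by unfold haarProbability; infer_instance
  set φ : G → ℝ := fun g => β * ∫ U, (wilsonBoundaryAction ρ {e} (Function.update U e (g⁻¹ * U e)) -
      wilsonBoundaryAction ρ {e} U) ∂μ with hφ
  have hφ0 : ∀ g, 0 ≤ φ g := fun g => hμ.mul_integral_shiftAction_nonneg ρ hρ e g
  have hφc : Continuous φ := continuous_const.mul (continuous_integral_shiftAction ρ hρ μ e)
  have hφint : ∫ g, φ g ∂(haarProbability G) = β * ∑ p ∈ plaquettesTouching ({e} : Finset (ZdEdge d)),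
      ∫ U, plaquetteObs ρ p.1 p.2.1.1 p.2.1.2 U ∂μ := by
    simp only [hφ]
    rw [integral_const_mul, integral_haar_integral_shiftAction ρ hρ hρ0 μ e]
  rw [← hφint]
  have hnn : 0 ≤ ∫ g, φ g ∂(haarProbability G) := integral_nonneg fun g => hφ0 g
  rcases hnn.lt_or_eq with hlt | heq
  · exact hlt
  · exfalso
    -- `φ ≡ 0`, hence `∫ Δ_g dμ = 0` and `Δ_g ≡ 0` for every `g`
    have hae : φ =ᵐ[haarProbability G] 0 :=
      (integral_eq_zero_iff_of_nonneg hφ0 (integrable_haar_of_continuous hφc)).1 heq.symm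
    have hφz : φ = 0 := (Continuous.ae_eq_iff_eq (haarProbability G) hφc continuous_const).1 hae
    have hΔ0 : ∀ g U, wilsonBoundaryAction ρ {e} (Function.update U e (g⁻¹ * U e)) -
        wilsonBoundaryAction ρ {e} U = 0 := fun g => by
      refine hμ.shiftAction_eq_zero_of_integral_eq_zero ρ hρ hβ e g ?_
      have h := congrFun hφz g
      simp only [hφ, Pi.zero_apply, mul_eq_zero] at h
      exact h.resolve_left hβ
    -- at the trivial configuration: `Re tr ρ(g) = N` for every `g`, contradicting `hρ0`
    have hcard : (0 : ℝ) < (plaquettesTouching ({e} : Finset (ZdEdge d))).card := by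
      exact_mod_cast Finset.card_pos.2 (plaquettesTouching_singleton_nonempty hd e)
    have htr : ∀ g : G, ((ρ g).trace).re = N := fun g => by
      have h := hΔ0 g 1
      rw [shiftAction_one ρ hρ e g] at h
      rcases mul_eq_zero.1 h with h' | h'
      · exact absurd h' hcard.ne'
      · linarith
    have h1 := hρ0 1
    simp only [mul_one, htr, integral_const, probReal_univ, smul_eq_mul, one_mul] at h1
    exact (NeZero.ne N) (by exact_mod_cast h1)

/-- ★★★ `β < 0`: the mean plaquette around every link is NEGATIVE in every DLR state. -/
theorem IsHaarShiftState.sum_integral_plaquetteObs_neg_of_neg (hρ : Continuous ρ)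
    (hρ0 : ∀ m : G, ∫ g, ((ρ (g * m)).trace).re ∂(haarProbability G) = 0) (hd : 2 ≤ d) {β : ℝ}
    (hβ : β < 0) {μ : Measure (LGConfig d G)} [IsProbabilityMeasure μ] (hμ : IsHaarShiftState ρ β μ)
    (e : ZdEdge d) :
    ∑ p ∈ plaquettesTouching ({e} : Finset (ZdEdge d)),
      ∫ U, plaquetteObs ρ p.1 p.2.1.1 p.2.1.2 U ∂μ < 0 := by
  have h := hμ.mul_sum_integral_plaquetteObs_pos ρ hρ hρ0 hd hβ.ne e
  by_contra hge
  push Not at hge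
  nlinarith

/-- ★★★ `β > 0`: the mean plaquette around every link is POSITIVE in every DLR state. -/
theorem IsHaarShiftState.sum_integral_plaquetteObs_pos_of_pos (hρ : Continuous ρ)
    (hρ0 : ∀ m : G, ∫ g, ((ρ (g * m)).trace).re ∂(haarProbability G) = 0) (hd : 2 ≤ d) {β : ℝ}
    (hβ : 0 < β) {μ : Measure (LGConfig d G)} [IsProbabilityMeasure μ] (hμ : IsHaarShiftState ρ β μ)
    (e : ZdEdge d) :
    0 < ∑ p ∈ plaquettesTouching ({e} : Finset (ZdEdge d)),
      ∫ U, plaquetteObs ρ p.1 p.2.1.1 p.2.1.2 U ∂μ := by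
  have h := hμ.mul_sum_integral_plaquetteObs_pos ρ hρ hρ0 hd hβ.ne' e
  exact pos_of_mul_pos_right h hβ.le

end SignRule

/-! ## Consequences: Class B at negative coupling for every representation without invariants;
infinite-volume limit points -/

section Consequences

variable [NeZero N] [SecondCountableTopology G]

omit [NeZero N] [SecondCountableTopology G] in
/-- **A central scalar excludes invariant vectors**: if `ρ z = ω • 1` with `ω ≠ 1` then
`∫ Re tr ρ(g m) dg = 0` for every `m` (left invariance of Haar measure under `g ↦ z g`). -/
theorem integral_re_trace_mul_eq_zero_of_smul_one (hρ : Continuous ρ) {z : G} {ω : ℂ}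
    (hz : ρ z = ω • (1 : Matrix (Fin N) (Fin N) ℂ)) (hω : ω ≠ 1) (m : G) :
    ∫ g, ((ρ (g * m)).trace).re ∂(haarProbability G) = 0 := by
  set J : ℂ := ∫ g, (ρ (g * m)).trace ∂(haarProbability G) with hJ
  have hc : Continuous fun g : G => (ρ (g * m)).trace :=
    (hρ.comp (continuous_id.mul continuous_const)).matrix_trace
  have hint : Integrable (fun g : G => (ρ (g * m)).trace) (haarProbability G) :=
    hc.integrable_of_hasCompactSupport (HasCompactSupport.of_compactSpace _)
  have hshift := integral_mul_left_eq_self (μ := haarProbability G) (fun g : G => (ρ (g * m)).trace) z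
  have hmul : ∀ g : G, (ρ (z * g * m)).trace = ω * (ρ (g * m)).trace := fun g => by
    rw [mul_assoc, map_mul, hz, Matrix.smul_mul, Matrix.one_mul, Matrix.trace_smul, smul_eq_mul]
  simp only [hmul] at hshift
  rw [integral_const_mul] at hshift
  -- `ω J = J`, `ω ≠ 1` ⇒ `J = 0`
  have hJ0 : J = 0 := by
    have h : (ω - 1) * J = 0 := by rw [sub_mul, one_mul, hshift, sub_self]
    rcases mul_eq_zero.1 h with h' | h'
    · exact absurd (sub_eq_zero.1 h') hω
    · exact h'
  have hre := integral_re hint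
  simp only [RCLike.re_to_complex] at hre
  rw [hre]
  change J.re = 0
  rw [hJ0, Complex.zero_re]

/-- ★★★ **Class B is empty at `β < 0` for every representation without invariant vectors**
(`∫ Re tr ρ(g m) dg = 0` for all `m`; `N ≥ 1`, `d ≥ 2`): diagonal RP and translation invariance give
`u_p ≥ 0` for every plaquette (`ClassBState.integral_plaquetteObs_nonneg`), the DLR sign rule gives
`Σ_{p ∋ e} u_p < 0`. Generalises `ClassBState.false_of_neg` (central scalar). -/
theorem ClassBState.false_of_neg' (hρ : Continuous ρ)
    (hρ0 : ∀ m : G, ∫ g, ((ρ (g * m)).trace).re ∂(haarProbability G) = 0) (hd : 2 ≤ d) {β : ℝ}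
    (hβ : β < 0) (w : ClassBState d ρ β) : False := by
  haveI := w.isProbabilityMeasure
  set e : ZdEdge d := ((0 : Fin d → ℤ), (⟨0, by omega⟩ : Fin d))
  have hneg := w.haarShift.sum_integral_plaquetteObs_neg_of_neg ρ hρ hρ0 hd hβ e
  have hnn : 0 ≤ ∑ p ∈ plaquettesTouching ({e} : Finset (ZdEdge d)),
      ∫ U, plaquetteObs ρ p.1 p.2.1.1 p.2.1.2 U ∂w.μ :=
    Finset.sum_nonneg fun p _ => w.integral_plaquetteObs_nonneg ρ hρ p.1 (ne_of_lt p.2.2)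
  linarith

/-- ★★★ `ClassBState d ρ β` is empty for `β < 0` (`ρ` without invariant vectors, `d ≥ 2`). -/
theorem isEmpty_classBState_of_neg' (hρ : Continuous ρ)
    (hρ0 : ∀ m : G, ∫ g, ((ρ (g * m)).trace).re ∂(haarProbability G) = 0) (hd : 2 ≤ d) {β : ℝ}
    (hβ : β < 0) : IsEmpty (ClassBState d ρ β) :=
  ⟨fun w => ClassBState.false_of_neg' ρ hρ hρ0 hd hβ w⟩

/-- ★★★ `ThermodynamicLimitIsClassB d ρ β` is false for `β < 0` (`ρ` without invariant vectors). -/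
theorem not_thermodynamicLimitIsClassB_of_neg' [NeZero d] [T2Space G] (hρ : Continuous ρ)
    (hρ0 : ∀ m : G, ∫ g, ((ρ (g * m)).trace).re ∂(haarProbability G) = 0) (hd : 2 ≤ d) {β : ℝ}
    (hβ : β < 0) : ¬ ThermodynamicLimitIsClassB d ρ β := by
  intro h
  obtain ⟨μ, hμ⟩ := infiniteVolumeLimitPoints_nonempty_holds (d := d) ρ hρ β
  obtain ⟨w, -⟩ := h μ hμ
  exact ClassBState.false_of_neg' ρ hρ hρ0 hd hβ w

/-- ★★ **Infinite-volume limit points obey the DLR sign rule**: at `β ≠ 0` every limit point of the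
torus Wilson states (a one-link Haar-shift state, tree) has `0 < β · Σ_{p ∋ e} ∫ Re tr ρ(U_p) dμ`
for every link `e`. -/
theorem mul_sum_integral_plaquetteObs_pos_of_mem_infiniteVolumeLimitPoints [NeZero d] [T2Space G]
    (hρ : Continuous ρ) (hρ0 : ∀ m : G, ∫ g, ((ρ (g * m)).trace).re ∂(haarProbability G) = 0)
    (hd : 2 ≤ d) {β : ℝ} (hβ : β ≠ 0) {μ : Measure (LGConfig d G)}
    (hμ : μ ∈ infiniteVolumeLimitPoints (d := d) ρ β) (e : ZdEdge d) :
    0 < β * ∑ p ∈ plaquettesTouching ({e} : Finset (ZdEdge d)),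
      ∫ U, plaquetteObs ρ p.1 p.2.1.1 p.2.1.2 U ∂μ := by
  obtain ⟨hprob, -, -, -, hhaar⟩ := classBInvariances_of_mem_infiniteVolumeLimitPoints ρ hρ hμ
  exact hhaar.mul_sum_integral_plaquetteObs_pos ρ hρ hρ0 hd hβ e

end Consequences

/-! ## The concrete groups -/

section Groups

/-- ★★★ **`SU(N)` (`N ≥ 2`), `d ≥ 2`, any DLR state at `β ≠ 0`: the mean plaquette around every link
has the strict sign of `β`.** -/
theorem mul_sum_integral_plaquetteObs_pos_suN {d N : ℕ} (hd : 2 ≤ d) (hN : 2 ≤ N) {β : ℝ} (hβ : β ≠ 0)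
    {μ : Measure (LGConfig d (Matrix.specialUnitaryGroup (Fin N) ℂ))} [IsProbabilityMeasure μ]
    (hμ : IsHaarShiftState (fundamentalRep (Fin N)) β μ)
    (e : ZdEdge d) :
    0 < β * ∑ p ∈ plaquettesTouching ({e} : Finset (ZdEdge d)),
      ∫ U, plaquetteObs (fundamentalRep (Fin N)) p.1 p.2.1.1 p.2.1.2 U ∂μ := by
  haveI : NeZero N := ⟨by omega⟩
  haveI : SecondCountableTopology (Matrix (Fin N) (Fin N) ℂ) :=
    inferInstanceAs (SecondCountableTopology (Fin N → Fin N → ℂ))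
  haveI : SecondCountableTopology (Matrix.specialUnitaryGroup (Fin N) ℂ) :=
    Topology.IsEmbedding.subtypeVal.secondCountableTopology
  obtain ⟨z, ζ, hζ1, hz, -⟩ :=
    Literature.MathematicalPhysics.QuantumFieldTheory.IsSpecialUnitaryModel.exists_central
      (fundamentalRep (Fin N))
      (Literature.MathematicalPhysics.QuantumFieldTheory.TorusAreaLaw.isSpecialUnitaryModel_fundamentalRep
        N) hN
  exact hμ.mul_sum_integral_plaquetteObs_pos (fundamentalRep (Fin N)) (continuous_fundamentalRep (Fin N))
    (integral_re_trace_mul_eq_zero_of_smul_one (fundamentalRep (Fin N))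
      (continuous_fundamentalRep (Fin N)) hz hζ1) hd hβ e

end Groups

end

end Summit.QuantumFields.GaugeBoot
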